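import Summits.Parity.GeneralizedHardyLittlewood.Theorems.LeeYangFibresCellParityLawModelPrimeSumIntegerSum
import HarnessLib

/-!
# Route `LeeYangFibres`, crux `CellParityLaw` (stmt-Parity-14109), line `section-annihilator`:
# the registered stub `stub_modelPrimeSum` — the model prime sum with rate

Skeleton v18 (lead c5). This file proves `ModelPrimeSum` (vocabulary file `LeeYangFibresCellParityLawP2Defs`):
for kernel-admissible data `(𝒜, x, η, Λ, w₀, R)` with `x ≥ x₀`, `z ∈ [x^{1/(u+1)}, x^{1/2}]`, parameters in
range and `m ≥ 1`,

  `|Σ_{z<p≤x} I_m(u_p) e^γ V(p) A_p(x)/u_p − I_{m+1}(u') T(𝒜; x, z)| ≤ C (log z)⁻¹ V(z) A(x) + C R`,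

`u_p = log(x/p)/log p`, `V(v) = ∏_{q<v}(1 − g q)`, `A_p(x) = Σ_{n≤x, p∣n} a_n`, `T = e^γ V(z) A(x)/u'`,
`u' = log x/log z`: the fibres' `m`-cell models at their own prime scales add up to the parent's `(m+1)`-cell
model (the MODEL side of the Buchstab induction step of the kernel).

Proof (finite Abel summation over the integers and one Riemann sum; tools in
`LeeYangFibresCellParityLawModelPrimeSumAux`, `…ModelPrimeSumIntegerSum`):

* the summands with `p > x^{1/2}` vanish (`u_p < 1 ≤ m`), so the sum runs over the primes of
  `(⌊z⌋, ⌊x^{1/2}⌋]`; `A_p = g(p)A + r_p` with `0 ≤ I_m(u)/u ≤ 1`, `0 ≤ V ≤ 1` and `Σ_p |r_p(x)| ≤ R` (the primes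
  `≤ x^{1/2} ≤ x^{1-η}` are squarefree members of the strong Type-I index set, selection `y_d = x`);
* `g(p)V(p) = V(p) − V(p+1)` and `V(n) = V(n+1)` at non-primes: the main sum is
  `e^γ A Σ_n (V(n) − V(n+1)) Φ(n)`, `Φ(n) = I_m(u_n)/u_n`, evaluated by `integer_sum_estimate` as
  `e^γ A (V(z) I_{m+1}(u')/u' + O((u+1)(L'+1) V(z)/log z))` (two-sided Mertens model `V(z) log z/log n`, Abel
  summation with the variation of `Φ` bounded by `2u`, and the right-endpoint Riemann sum of the `2`-Lipschitz
  weight `I_m(t)/t` over the partition `u_n` of `[1, u'−1]` of mesh `≤ log x/(z log² z)`, `roughCellDensity_succ`).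

Constants: `C = 2(u+1)(4|L'| + 4)`, `x₀ = exp((u+1)(2|L'| + 4))` (so that `log z ≥ 2|L'| + 4`, `w₀ ≤ z`).

References: E. Bombieri, Rend. Accad. Naz. XL (5) 1/2 (1975/76) §1 [BombieriAsymptoticSieve1976];
E. Bombieri, RIMS Kôkyûroku 294 (1977) p. 5 [BombieriRIMS1977]; K. Alladi, Quart. J. Math. Oxford (2) 33
(1982) [Alladi1982].
-/

noncomputable section

open scoped BigOperators Classical
open Finset Literature.NumberTheory.Sieve

namespace Summit.Parity.GeneralizedHardyLittlewood.Cruxes.CellParityLaw.SectionAnnihilator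

open ModelPrimeSumAux in
/-- **`stub_modelPrimeSum`** (registered stub of skeleton v18, line `section-annihilator`): the model prime
sum with rate. For kernel-admissible data, `m ≥ 1`, `x ≥ x₀`, `z ∈ [x^{1/(u+1)}, x^{1/2}]`:
`|Σ_{z<p≤x} I_m(u_p) e^γ V(p) A_p(x)/u_p − I_{m+1}(u') T(𝒜; x, z)| ≤ C (log z)⁻¹ V(z) A(x) + C R`.
Proof: `A_p = g(p) A + r_p` with `Σ_{p ≤ x^{1/2}} |r_p(x)| ≤ R` (strong Type-I, selection `y_d = x`; the
summands with `p > x^{1/2}` vanish) and `0 ≤ I_m(u)/u ≤ 1`; `g(p)V(p) = V(p) − V(p+1)` telescopes over the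
INTEGERS `n ∈ (⌊z⌋, ⌊x^{1/2}⌋]`, and `integer_sum_estimate` (Abel summation against the two-sided Mertens
model, bounded variation of the weight, Riemann sum + `roughCellDensity_succ`) evaluates that sum as
`V(z) I_{m+1}(u')/u' + O((u+1)(L'+1) V(z)/log z)`. Constants: `C = 2(u+1)(4|L'| + 4)`,
`x₀ = exp((u+1)(2|L'| + 4))`. -/
theorem stub_modelPrimeSum : ModelPrimeSum := by
  intro u A₁ L' hu
  set Gc : ℝ := Real.exp Real.eulerMascheroniConstant with hGc
  have hGc0 : 0 < Gc := Real.exp_pos _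
  have hGc2 : Gc ≤ 2 := by
    have h1 : Real.eulerMascheroniConstant < Real.log 2 := by
      linarith [Real.eulerMascheroniConstant_lt_two_thirds, Real.log_two_gt_d9]
    have h2 := Real.exp_lt_exp.mpr h1
    rw [Real.exp_log two_pos] at h2
    exact h2.le
  have hu2 : (2 : ℝ) ≤ u := by exact_mod_cast hu
  have hu10 : (0 : ℝ) < (u : ℝ) + 1 := by linarith
  have hAL : 0 ≤ |L'| := abs_nonneg _
  set K : ℝ := ((u : ℝ) + 1) * (4 * |L'| + 4) with hK
  have hK12 : 12 ≤ K := by rw [hK]; nlinarith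
  refine ⟨2 * K, Real.exp (((u : ℝ) + 1) * (2 * |L'| + 4)), by linarith, ?_⟩
  intro 𝒜 x z η Λ w₀ R hx₀ hzlo hzhi hKR hKA m hm
  obtain ⟨-, hηhi, -, -, hw₀2, hw₀hi⟩ := hKR
  obtain ⟨-, -, -, hsize, -, hdim, hMert, hTypeI⟩ := hKA
  have hL'0 : 0 ≤ L' := hdim.nonneg
  have habsL : |L'| = L' := abs_of_nonneg hL'0
  /- 1. ranges of `x`, `z`, `η` -/
  have hx0 : 0 < x := (Real.exp_pos _).trans_le hx₀
  obtain ⟨lx, hlx⟩ : ∃ lx : ℝ, lx = Real.log x := ⟨_, rfl⟩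
  have hlxge : ((u : ℝ) + 1) * (2 * |L'| + 4) ≤ lx := by
    rw [hlx, ← Real.log_exp (((u : ℝ) + 1) * (2 * |L'| + 4))]
    exact Real.log_le_log (Real.exp_pos _) hx₀
  have hlx12 : 12 ≤ lx := by
    have h4 : ((u : ℝ) + 1) * 4 ≤ ((u : ℝ) + 1) * (2 * |L'| + 4) :=
      mul_le_mul_of_nonneg_left (by linarith) hu10.le
    linarith
  have hx1 : 1 < x := by
    by_contra h
    have := Real.log_nonpos hx0.le (not_lt.mp h)
    linarith
  have hz0 : 0 < z := (Real.rpow_pos_of_pos hx0 _).trans_le hzlo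
  obtain ⟨lz, hlz⟩ : ∃ lz : ℝ, lz = Real.log z := ⟨_, rfl⟩
  have hlzlo : lx / ((u : ℝ) + 1) ≤ lz := by
    have h := Real.log_le_log (Real.rpow_pos_of_pos hx0 _) hzlo
    rw [Real.log_rpow hx0, ← hlx, ← hlz] at h
    calc lx / ((u : ℝ) + 1) = 1 / ((u : ℝ) + 1) * lx := by ring
      _ ≤ lz := h
  have hlz4 : 2 * |L'| + 4 ≤ lz := by
    refine le_trans ?_ hlzlo
    rw [le_div_iff₀ hu10]
    linarith
  have hlz0 : 0 < lz := by linarith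
  have hlxlz : lx ≤ ((u : ℝ) + 1) * lz := by
    rw [div_le_iff₀ hu10] at hlzlo
    linarith
  set xh : ℝ := x ^ (1 / 2 : ℝ) with hxh
  have hxhpos : 0 < xh := Real.rpow_pos_of_pos hx0 _
  have hlxh : Real.log xh = lx / 2 := by rw [hxh, Real.log_rpow hx0, ← hlx]; ring
  have hxη : x ^ η ≤ x ^ (1 / ((u : ℝ) + 1)) :=
    Real.rpow_le_rpow_of_exponent_le hx1.le
      (hηhi.trans (one_div_le_one_div_of_le hu10 (by linarith)))
  have hw₀z : w₀ ≤ z := hw₀hi.trans (hxη.trans hzlo)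
  have hz2 : 2 ≤ z := hw₀2.trans hw₀z
  have hzxh : z ≤ xh := hzhi
  have hxh2 : 2 ≤ xh := hz2.trans hzxh
  have hxhsq : xh * xh = x := by rw [hxh, ← Real.sqrt_eq_rpow, Real.mul_self_sqrt hx0.le]
  have hxhx : xh ≤ x := by nlinarith
  have hη8 : η ≤ 1 / 8 := hηhi.trans (one_div_le_one_div_of_le (by norm_num) (by linarith))
  have hxhy : xh ≤ x ^ (1 - η) := Real.rpow_le_rpow_of_exponent_le hx1.le (by linarith)
  have hL2 : 2 * L' ≤ lz := by rw [← habsL]; linarith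
  /- 2. notation; the integer-sum estimate -/
  set A : ℝ := 𝒜.size x with hA
  have hA0 : 0 ≤ A := by
    rw [hA, hsize]
    exact Finset.sum_nonneg fun n _ => 𝒜.a_nonneg n
  set V : ℝ := 𝒜.densityProduct (primesProdBelow z) with hV
  have hV0 : 0 ≤ V := (densityProduct_mem_Icc 𝒜 hdim.1 _).1
  set a : ℕ := ⌊z⌋₊ with ha
  set b : ℕ := ⌊xh⌋₊ with hb
  set W : ℕ → ℝ := fun n => 𝒜.densityProduct (primesProdBelow (n : ℝ)) with hW
  have hW01 : ∀ n, 0 ≤ W n ∧ W n ≤ 1 := fun n => densityProduct_mem_Icc 𝒜 hdim.1 _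
  set t : ℕ → ℝ := fun n => Real.log (x / n) / Real.log n with ht
  set S : ℝ := ∑ n ∈ Ioc a b, (W n - W (n + 1)) * (roughCellDensity m (t n) / t n) with hS
  set I : ℝ := roughCellDensity (m + 1) (lx / lz) with hI
  have hmain : |S - V * (lz / lx) * I| ≤ ((u : ℝ) + 1) * (4 * L' + 2) * V / lz :=
    integer_sum_estimate 𝒜 hm hdim hMert hw₀z hz2 hzxh hx1 hlx hlz hL2 hlxlz
  /- 3. the prime sum: restriction to `z < p ≤ x^{1/2}`, `A_p = g(p)A + r_p`, telescoping -/
  have hsum1 : (∑ p ∈ (Finset.Ioc 0 ⌊x⌋₊).filter (fun p : ℕ => p.Prime ∧ z < (p : ℝ)),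
        roughCellDensity m (t p) * (Gc * W p * 𝒜.congrSum p x / t p)) =
      ∑ p ∈ (Finset.Ioc a b).filter Nat.Prime,
        roughCellDensity m (t p) * (Gc * W p * 𝒜.congrSum p x / t p) := by
    symm
    apply Finset.sum_subset
    · intro p hp
      simp only [Finset.mem_filter, Finset.mem_Ioc] at hp ⊢
      obtain ⟨⟨hap, hpb⟩, hpp⟩ := hp
      exact ⟨⟨by omega, hpb.trans (Nat.floor_mono hxhx)⟩, hpp, (Nat.floor_lt hz0.le).mp hap⟩
    · intro p hp hnp
      simp only [Finset.mem_filter, Finset.mem_Ioc, not_and] at hp hnp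
      obtain ⟨-, hpp, hzp⟩ := hp
      have hap : a < p := (Nat.floor_lt hz0.le).mpr hzp
      have hbp : b < p := by
        by_contra h
        exact hnp ⟨hap, not_lt.mp h⟩ hpp
      have hxhp : xh < p := (Nat.floor_lt hxhpos.le).mp hbp
      have hp0 : (0 : ℝ) < p := hxhpos.trans hxhp
      have hlp : lx / 2 < Real.log p := by
        rw [← hlxh]
        exact Real.log_lt_log hxhpos hxhp
      have htp : t p < 1 := by
        show Real.log (x / p) / Real.log p < 1
        rw [Real.log_div hx0.ne' hp0.ne', ← hlx, div_lt_one (by linarith)]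
        linarith
      rw [roughCellDensity_of_lt_one m htp, zero_mul]
  have hsum2 : ∑ p ∈ (Finset.Ioc a b).filter Nat.Prime,
        roughCellDensity m (t p) * (Gc * W p * 𝒜.congrSum p x / t p) =
      Gc * A * ∑ p ∈ (Finset.Ioc a b).filter Nat.Prime,
          𝒜.density p * W p * (roughCellDensity m (t p) / t p) +
        Gc * ∑ p ∈ (Finset.Ioc a b).filter Nat.Prime,
          W p * (roughCellDensity m (t p) / t p) * 𝒜.remainder p x := by
    rw [Finset.mul_sum, Finset.mul_sum, ← Finset.sum_add_distrib]
    refine Finset.sum_congr rfl fun p _ => ?_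
    simp only [SieveSequence.remainder, ← hA]
    ring
  have hsum3 : ∑ p ∈ (Finset.Ioc a b).filter Nat.Prime,
        𝒜.density p * W p * (roughCellDensity m (t p) / t p) = S := by
    rw [hS, Finset.sum_filter]
    refine Finset.sum_congr rfl fun n _ => ?_
    have hWn : W n - W (n + 1) = if n.Prime then 𝒜.density n * W n else 0 :=
      densityProduct_natCast_sub_succ 𝒜 n
    rw [hWn]
    split_ifs with hp
    · rfl
    · rw [zero_mul]
  -- the remainder part is bounded by the strong Type-I sum with the constant selection `y_d = x`
  have hTI := hTypeI (fun _ => x) fun _ => le_rfl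
  have hR0 : 0 ≤ R := le_trans (Finset.sum_nonneg fun _ _ => abs_nonneg _) hTI
  have hErr : |∑ p ∈ (Finset.Ioc a b).filter Nat.Prime,
      W p * (roughCellDensity m (t p) / t p) * 𝒜.remainder p x| ≤ R := by
    calc |∑ p ∈ (Finset.Ioc a b).filter Nat.Prime,
            W p * (roughCellDensity m (t p) / t p) * 𝒜.remainder p x|
        ≤ ∑ p ∈ (Finset.Ioc a b).filter Nat.Prime,
            |W p * (roughCellDensity m (t p) / t p) * 𝒜.remainder p x| :=
          Finset.abs_sum_le_sum_abs _ _
      _ ≤ ∑ p ∈ (Finset.Ioc a b).filter Nat.Prime, |𝒜.remainder p x| :=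
          Finset.sum_le_sum fun p _ => by
            rw [abs_mul, abs_mul, abs_of_nonneg (hW01 p).1,
              abs_of_nonneg (weight_mem_Icc hm (t p)).1]
            exact mul_le_of_le_one_left (abs_nonneg _)
              (mul_le_one₀ (hW01 p).2 (weight_mem_Icc hm (t p)).1 (weight_mem_Icc hm (t p)).2)
      _ ≤ ∑ d ∈ (Finset.Icc 1 ⌊x ^ (1 - η)⌋₊).filter Squarefree, |𝒜.remainder d x| := by
          refine Finset.sum_le_sum_of_subset_of_nonneg (fun p hp => ?_) fun _ _ _ => abs_nonneg _
          simp only [Finset.mem_filter, Finset.mem_Ioc, Finset.mem_Icc] at hp ⊢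
          obtain ⟨⟨-, hpb⟩, hpp⟩ := hp
          exact ⟨⟨hpp.pos, hpb.trans (Nat.floor_mono hxhy)⟩, hpp.prime.squarefree⟩
      _ ≤ R := hTI
  /- 4. assembly -/
  show |(∑ p ∈ (Finset.Ioc 0 ⌊x⌋₊).filter (fun p : ℕ => p.Prime ∧ z < (p : ℝ)),
      roughCellDensity m (t p) * (Gc * W p * 𝒜.congrSum p x / t p)) -
      roughCellDensity (m + 1) (Real.log x / Real.log z) * primeMain 𝒜 x z| ≤
    2 * K * (Real.log z)⁻¹ * (V * A) + 2 * K * R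
  rw [hsum1, hsum2, hsum3]
  unfold primeMain
  rw [← hGc, ← hV, ← hA, ← hlx, ← hlz, ← hI]
  set Err : ℝ := ∑ p ∈ (Finset.Ioc a b).filter Nat.Prime,
    W p * (roughCellDensity m (t p) / t p) * 𝒜.remainder p x with hErr'
  have hlx0 : 0 < lx := by linarith
  have e : Gc * A * S + Gc * Err - I * (Gc * V * A / (lx / lz)) =
      Gc * A * (S - V * (lz / lx) * I) + Gc * Err := by
    field_simp
    ring
  rw [e]
  have hfin1 : |Gc * A * (S - V * (lz / lx) * I)| ≤ Gc * A * (K * V / lz) := by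
    rw [abs_mul, abs_of_nonneg (mul_nonneg hGc0.le hA0)]
    refine mul_le_mul_of_nonneg_left (hmain.trans ?_) (mul_nonneg hGc0.le hA0)
    rw [hK, habsL]
    refine div_le_div_of_nonneg_right (mul_le_mul_of_nonneg_right ?_ hV0) hlz0.le
    exact mul_le_mul_of_nonneg_left (by linarith) hu10.le
  have hfin2 : |Gc * Err| ≤ Gc * R := by
    rw [abs_mul, abs_of_pos hGc0]
    exact mul_le_mul_of_nonneg_left hErr hGc0.le
  have hfin3 : Gc * A * (K * V / lz) ≤ 2 * A * (K * V / lz) :=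
    mul_le_mul_of_nonneg_right (mul_le_mul_of_nonneg_right hGc2 hA0) (by positivity)
  have hfin4 : Gc * R ≤ 2 * K * R := mul_le_mul_of_nonneg_right (by linarith) hR0
  have e2 : 2 * A * (K * V / lz) = 2 * K * lz⁻¹ * (V * A) := by
    rw [div_eq_mul_inv]
    ring
  calc |Gc * A * (S - V * (lz / lx) * I) + Gc * Err|
      ≤ |Gc * A * (S - V * (lz / lx) * I)| + |Gc * Err| := abs_add_le _ _
    _ ≤ Gc * A * (K * V / lz) + Gc * R := add_le_add hfin1 hfin2
    _ ≤ 2 * K * lz⁻¹ * (V * A) + 2 * K * R := by linarith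

end Summit.Parity.GeneralizedHardyLittlewood.Cruxes.CellParityLaw.SectionAnnihilator

end
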